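/-
Copyright (c) 2026. Released under Apache 2.0 license as described in the file LICENSE.
-/
import Literature.NumberTheory.Rogawski1990.DepthZeroTransferHValuesTypeOne
import Literature.NumberTheory.Rogawski1990.DepthZeroTransferHValuesTypeTwoChi
import Literature.NumberTheory.Rogawski1990.UnitOrbitalIntegralIdentityGermCombination
import HarnessLib

/-!
# T3′'s H-side values under the depth shift `N ↦ N − 1`: the matrix `S = !![1, −q⁻¹; 0, q⁻¹]` (road «S3-tree», LIFT `_le_one ↦ _le_two`, H-side organ)

Topic `NumberTheory/Rogawski1990`; namespaces `Literature.NumberTheory.Rogawski1990` (§1–§2) and `Literature.NumberTheory.Automorphic.UnitaryGroup` (§3).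
THEOREMS ONLY (no definition, no instance, no notation, no named fact, no `sorry`).  Cell `pub/hodgecm-mathlib` (D-0151), crux H413 =
`stmt-HodgeConjecture-24833`, road «S3-tree»; architect A-p16 A-88 (6)(iii), A-91b («`S` holds for all three populations»), A-93 (1); END F0P3a-p03 (g15).
HONEST LABEL: HC_CM is proved only modulo the 2 remaining named inputs (hLiu418 24832, h413 24833) until rung 0 closes; nothing printed is asserted here.

THE MATHEMATICS.  Let `H = U(2) × U(1)` over `L⁺_v` at an unramified non-split place `v` of the CM field `L` (`w` the place above), `K_H` its hyperspecial subgroup,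
`χ₀ = 1_{K_H}·[(red h_{2,w} − 1)² = 0 ∧ rank (red h_{2,w} − 1) = 0]` and `χ₁ = 1_{K_H}·[… ∧ rank (…) = 1]` the two residual rank strata (T3′ HEAD v4).  By ★
`DepthZeroTransferHValuesTypeOne` ∕ `…TypeTwoChi`, for a `G`-regular `γ_H` of depth `N ≥ 1` in a torus of type (1) (resp. (2)),
`Φ^st(γ_H, χ₀) = ν_H(K_H)·F(N − 1)` and `Φ^st(γ_H, χ₁) = ν_H(K_H)·(F N − F (N − 1))` with `F = phiH q` (resp. `phiHtwo q`), and ★ `phiH_succ_sub_mul` ∕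
`phiHtwo_succ_sub_mul`: `F (M + 1) − q·F M = d_T` with `d_T ∈ {2, 1}` CONSTANT in `M`.
* §1 `apply_sub_two_eq_of_succ_sub_mul_eq`: for ANY sequence with `F (M + 1) − q·F M = d` constant and `q ≠ 0`, `2 ≤ N`:
  `F (N − 2) = F (N − 1) − q⁻¹·(F N − F (N − 1))` and `F (N − 1) − F (N − 2) = q⁻¹·(F N − F (N − 1))` — the constant `d` cancels.
* §2 the three instances `phiH` (type (1)), `phiHtwo` (type (2)), `q ^ ·` (Levi; ★ `pow_succ_sub_mul_pow`).
* §3 **`stableOrbitalIntegralRel_chi_shift_of_isRoot`** (type (1)) and **`stableOrbitalIntegralRel_chi_shift_of_not_exists_isRoot`** (type (2)): if `γ_H` has depth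
  `N ≥ 2` and `u_H` (same torus type, same `mH`, `ν_H`) has depth `N − 1`, then
  `Φ^st(u_H, χ₀) = Φ^st(γ_H, χ₀) − q⁻¹·Φ^st(γ_H, χ₁)` and `Φ^st(u_H, χ₁) = q⁻¹·Φ^st(γ_H, χ₁)`,
  i.e. `Φ^st(u_H, χ_s) = Σ_k S_{sk} Φ^st(γ_H, χ_k)` with `S = !![1, −q⁻¹; 0, q⁻¹]` INDEPENDENT OF THE TORUS — the H-side half of the lift of the depth-zero transfer near
  `1` from pieces of hyperspecial level `≤ 1` to level `≤ 2` (the Cayley shift `γ ↦ u` lowers the depth by one; Rogawski 1990 §4.9, Kottwitz 1986 §3).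
Depths are in the ROOT currency of ★ FILE B (`v_w(α − γ) = exp (−N)`) for type (1) and in the DISCRIMINANT currency of ★ FILE C∕D (`v_w(tr² − 4 det) = exp (−(2N+1))`)
for type (2); `q = Ideal.absNorm v.asIdeal`.

## References
* [Rogawski1990] J. D. Rogawski, *Automorphic Representations of Unitary Groups in Three Variables*, Ann. of Math. Stud. 123 (1990): §4.9 Prop. 4.9.1 p. 55; §3.6 p. 31.
* [Kottwitz1986] R. E. Kottwitz, *Base change for unit elements of Hecke algebras*, Compositio Math. 60 (1986): §3.
* [Flicker1998UnitaryFL] Y. Z. Flicker, *Elementary proof of the fundamental lemma for a unitary group*, Canad. J. Math. 50 (1998): §6 p. 97.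
-/

set_option autoImplicit false

noncomputable section

open MeasureTheory Measure Set Filter Topology NumberField IsDedekindDomain Matrix Polynomial ValuativeRel
open scoped ENNReal NNReal ValuativeRel Matrix MatrixGroups

/-! ## §1 The shift of a sequence with constant first-order defect -/

namespace Literature.NumberTheory.Rogawski1990

/-- **Constant defect ⇒ shift law**: if `F (M + 1) − q·F M = d` for every `M` and `q ≠ 0`, then for `2 ≤ N`
`F (N − 2) = F (N − 1) − q⁻¹·(F N − F (N − 1))` and `F (N − 1) − F (N − 2) = q⁻¹·(F N − F (N − 1))`. [cite: Rogawski1990, §4.9 Prop. 4.9.1 p. 55] -/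
theorem apply_sub_two_eq_of_succ_sub_mul_eq {K : Type*} [Field K] {q d : K} (hq : q ≠ 0) {F : ℕ → K}
    (hF : ∀ M, F (M + 1) - q * F M = d) {N : ℕ} (hN : 2 ≤ N) :
    F (N - 2) = F (N - 1) - q⁻¹ * (F N - F (N - 1)) ∧ F (N - 1) - F (N - 2) = q⁻¹ * (F N - F (N - 1)) := by
  obtain ⟨M, rfl⟩ : ∃ M, N = M + 2 := ⟨N - 2, by omega⟩
  rw [Nat.add_sub_cancel, show M + 2 - 1 = M + 1 from rfl]
  have h1 : F (M + 1) - q * F M = d := hF M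
  have h2 : F (M + 2) - q * F (M + 1) = d := hF (M + 1)
  have key : F (M + 2) - F (M + 1) = q * (F (M + 1) - F M) := by linear_combination h2 - h1
  have c2 : F (M + 1) - F M = q⁻¹ * (F (M + 2) - F (M + 1)) := by
    rw [key, ← mul_assoc, inv_mul_cancel₀ hq, one_mul]
  exact ⟨by linear_combination -c2, c2⟩

/-! ## §2 The three populations: `phiH` (type (1)), `phiHtwo` (type (2)), `q ^ ·` (Levi) -/

/-- Type (1): `phiH q (N − 2) = phiH q (N − 1) − q⁻¹·(phiH q N − phiH q (N − 1))` and `phiH q (N − 1) − phiH q (N − 2) = q⁻¹·(phiH q N − phiH q (N − 1))` (`1 < q`,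
`2 ≤ N`). [cite: Rogawski1990, §4.9 Prop. 4.9.1 (a) p. 55] -/
theorem phiH_sub_two_eq {q : ℕ} (hq : 1 < q) {N : ℕ} (hN : 2 ≤ N) :
    Flicker1998.phiH q (N - 2) = Flicker1998.phiH q (N - 1) - (q : ℚ)⁻¹ * (Flicker1998.phiH q N - Flicker1998.phiH q (N - 1)) ∧
    Flicker1998.phiH q (N - 1) - Flicker1998.phiH q (N - 2) = (q : ℚ)⁻¹ * (Flicker1998.phiH q N - Flicker1998.phiH q (N - 1)) :=
  apply_sub_two_eq_of_succ_sub_mul_eq (by exact_mod_cast (by omega : q ≠ 0)) (Flicker1998.phiH_succ_sub_mul (by omega : q ≠ 1)) hN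

/-- Type (2): `phiHtwo q (N − 2) = phiHtwo q (N − 1) − q⁻¹·(phiHtwo q N − phiHtwo q (N − 1))` and `phiHtwo q (N − 1) − phiHtwo q (N − 2) = q⁻¹·(phiHtwo q N − phiHtwo q (N − 1))`.
[cite: Rogawski1990, §4.9 Prop. 4.9.1 (b) p. 55] -/
theorem phiHtwo_sub_two_eq {q : ℕ} (hq : 1 < q) {N : ℕ} (hN : 2 ≤ N) :
    Flicker1998.phiHtwo q (N - 2) = Flicker1998.phiHtwo q (N - 1) - (q : ℚ)⁻¹ * (Flicker1998.phiHtwo q N - Flicker1998.phiHtwo q (N - 1)) ∧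
    Flicker1998.phiHtwo q (N - 1) - Flicker1998.phiHtwo q (N - 2) = (q : ℚ)⁻¹ * (Flicker1998.phiHtwo q N - Flicker1998.phiHtwo q (N - 1)) :=
  apply_sub_two_eq_of_succ_sub_mul_eq (by exact_mod_cast (by omega : q ≠ 0)) (Flicker1998.phiHtwo_succ_sub_mul (by omega : q ≠ 1)) hN

/-- Levi: `q ^ (N − 2) = q ^ (N − 1) − q⁻¹·(q ^ N − q ^ (N − 1))` and `q ^ (N − 1) − q ^ (N − 2) = q⁻¹·(q ^ N − q ^ (N − 1))` (`q ≠ 0`, `2 ≤ N`).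
[cite: Rogawski1990, §4.9 p. 54] -/
theorem pow_sub_two_eq {q : ℚ} (hq : q ≠ 0) {N : ℕ} (hN : 2 ≤ N) :
    q ^ (N - 2) = q ^ (N - 1) - q⁻¹ * (q ^ N - q ^ (N - 1)) ∧ q ^ (N - 1) - q ^ (N - 2) = q⁻¹ * (q ^ N - q ^ (N - 1)) :=
  apply_sub_two_eq_of_succ_sub_mul_eq hq (F := fun M => q ^ M) (Flicker1998.pow_succ_sub_mul_pow q) hN

end Literature.NumberTheory.Rogawski1990

/-! ## §3 The stable values of `χ₀, χ₁` under the shift: `S = !![1, −q⁻¹; 0, q⁻¹]` for both torus types -/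

namespace Literature.NumberTheory.Automorphic.UnitaryGroup

open Literature.NumberTheory.Rogawski1990 Literature.NumberTheory.Automorphic Literature.NumberTheory.Automorphic.IntegralReduction

section Place

variable (L : Type) [Field L] [NumberField L] [IsCMField L] (v : HeightOneSpectrum (𝓞 ↥(maximalRealSubfield L)))
  (w : PlacesOver L v) (hw : IsCMField.complexConj L • w.1 = w.1)
  [MeasurableSpace ((cmDatum L 2 (Matrix.of fun i j : Fin 2 => if i.val + j.val + 1 = 2 then (1 : L) else 0)).Local v × (cmDatum L 1 (Matrix.of fun i j : Fin 1 => if i.val + j.val + 1 = 1 then (1 : L) else 0)).Local v)] [BorelSpace ((cmDatum L 2 (Matrix.of fun i j : Fin 2 => if i.val + j.val + 1 = 2 then (1 : L) else 0)).Local v × (cmDatum L 1 (Matrix.of fun i j : Fin 1 => if i.val + j.val + 1 = 1 then (1 : L) else 0)).Local v)]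
  [∀ a : (cmDatum L 2 (Matrix.of fun i j : Fin 2 => if i.val + j.val + 1 = 2 then (1 : L) else 0)).Local v × (cmDatum L 1 (Matrix.of fun i j : Fin 1 => if i.val + j.val + 1 = 1 then (1 : L) else 0)).Local v, MeasurableSpace (((cmDatum L 2 (Matrix.of fun i j : Fin 2 => if i.val + j.val + 1 = 2 then (1 : L) else 0)).Local v × (cmDatum L 1 (Matrix.of fun i j : Fin 1 => if i.val + j.val + 1 = 1 then (1 : L) else 0)).Local v) ⧸ Subgroup.centralizer ({a} : Set ((cmDatum L 2 (Matrix.of fun i j : Fin 2 => if i.val + j.val + 1 = 2 then (1 : L) else 0)).Local v × (cmDatum L 1 (Matrix.of fun i j : Fin 1 => if i.val + j.val + 1 = 1 then (1 : L) else 0)).Local v)))]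
  [∀ a : (cmDatum L 2 (Matrix.of fun i j : Fin 2 => if i.val + j.val + 1 = 2 then (1 : L) else 0)).Local v × (cmDatum L 1 (Matrix.of fun i j : Fin 1 => if i.val + j.val + 1 = 1 then (1 : L) else 0)).Local v, BorelSpace (((cmDatum L 2 (Matrix.of fun i j : Fin 2 => if i.val + j.val + 1 = 2 then (1 : L) else 0)).Local v × (cmDatum L 1 (Matrix.of fun i j : Fin 1 => if i.val + j.val + 1 = 1 then (1 : L) else 0)).Local v) ⧸ Subgroup.centralizer ({a} : Set ((cmDatum L 2 (Matrix.of fun i j : Fin 2 => if i.val + j.val + 1 = 2 then (1 : L) else 0)).Local v × (cmDatum L 1 (Matrix.of fun i j : Fin 1 => if i.val + j.val + 1 = 1 then (1 : L) else 0)).Local v)))]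
  (νH : Measure ((cmDatum L 2 (Matrix.of fun i j : Fin 2 => if i.val + j.val + 1 = 2 then (1 : L) else 0)).Local v × (cmDatum L 1 (Matrix.of fun i j : Fin 1 => if i.val + j.val + 1 = 1 then (1 : L) else 0)).Local v)) [νH.IsHaarMeasure] [νH.IsMulRightInvariant]

set_option maxHeartbeats 400000 in
include hw in
/-- **H-SIDE SHIFT, TYPE (1): `Φ^st(u_H, χ₀) = Φ^st(γ_H, χ₀) − q⁻¹·Φ^st(γ_H, χ₁)` and `Φ^st(u_H, χ₁) = q⁻¹·Φ^st(γ_H, χ₁)`** for `G`-regular non-Levi `γ_H, u_H` whose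
`w`-characteristic polynomials split with roots `≡ 1 (mod 𝔪_w)` at depths `N ≥ 2` (`v_w(α − γ) = exp (−N)`) and `N − 1` (`v_w(α′ − γ′) = exp (−(N − 1))`): both sides are
`ν_H(K_H)` times the closed forms of ★ `stableOrbitalIntegralRel_chiZero_eq_mul_phiH_of_isRoot` ∕ `…chiOne_eq_mul_phiH_sub_of_isRoot`, and §2 `phiH_sub_two_eq`.  The
matrix `S = !![1, −q⁻¹; 0, q⁻¹]` does not depend on the torus (A-91b).  Decidability binders `χdec₀ χdec₁` (pass `_`).
[cite: Rogawski1990, §4.9 Prop. 4.9.1 (a) p. 55] [cite: Kottwitz1986, §3] [cite: Flicker1998UnitaryFL, §6 p. 97] -/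
theorem stableOrbitalIntegralRel_chi_shift_of_isRoot (hv : Algebra.IsUnramifiedIn (𝓞 L) v.asIdeal)
    {mH : OrbitalMeasureFamily ((cmDatum L 2 (Matrix.of fun i j : Fin 2 => if i.val + j.val + 1 = 2 then (1 : L) else 0)).Local v × (cmDatum L 1 (Matrix.of fun i j : Fin 1 => if i.val + j.val + 1 = 1 then (1 : L) else 0)).Local v)} (hmH : mH.IsCanonical (IsLocalGRegular L v) νH)
    {γH : (cmDatum L 2 (Matrix.of fun i j : Fin 2 => if i.val + j.val + 1 = 2 then (1 : L) else 0)).Local v × (cmDatum L 1 (Matrix.of fun i j : Fin 1 => if i.val + j.val + 1 = 1 then (1 : L) else 0)).Local v} (hreg : IsLocalGRegular L v γH)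
    (hell : ¬ ∃ (y : ((cmDatum L 2 (Matrix.of fun i j : Fin 2 => if i.val + j.val + 1 = 2 then (1 : L) else 0)).Local v × (cmDatum L 1 (Matrix.of fun i j : Fin 1 => if i.val + j.val + 1 = 1 then (1 : L) else 0)).Local v)) (d' : Fin 2 → (UnitaryGroup.LocalRing L v)ˣ),
        glDiagonal 2 (UnitaryGroup.LocalRing L v) d' = ((y * γH * y⁻¹).1.val : GL (Fin 2) (UnitaryGroup.LocalRing L v)))
    (α γ : (w.1.adicCompletion L))
    (hα : ((((γH.1.val : GL (Fin 2) (LocalRing L v)) : Matrix (Fin 2) (Fin 2) (LocalRing L v)).charpoly).map (Pi.evalRingHom (fun w' : PlacesOver L v => w'.1.adicCompletion L) w)).IsRoot α)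
    (hγ : ((((γH.1.val : GL (Fin 2) (LocalRing L v)) : Matrix (Fin 2) (Fin 2) (LocalRing L v)).charpoly).map (Pi.evalRingHom (fun w' : PlacesOver L v => w'.1.adicCompletion L) w)).IsRoot γ)
    (hαγ : α ≠ γ) (N : ℕ) (hN : Valued.v (α - γ) = WithZero.exp (-(N : ℤ)))
    (hα1 : Valued.v (α - 1) < 1) (hγ1 : Valued.v (γ - 1) < 1)
    {uH : (cmDatum L 2 (Matrix.of fun i j : Fin 2 => if i.val + j.val + 1 = 2 then (1 : L) else 0)).Local v × (cmDatum L 1 (Matrix.of fun i j : Fin 1 => if i.val + j.val + 1 = 1 then (1 : L) else 0)).Local v} (hreg' : IsLocalGRegular L v uH)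
    (hell' : ¬ ∃ (y : ((cmDatum L 2 (Matrix.of fun i j : Fin 2 => if i.val + j.val + 1 = 2 then (1 : L) else 0)).Local v × (cmDatum L 1 (Matrix.of fun i j : Fin 1 => if i.val + j.val + 1 = 1 then (1 : L) else 0)).Local v)) (d' : Fin 2 → (UnitaryGroup.LocalRing L v)ˣ),
        glDiagonal 2 (UnitaryGroup.LocalRing L v) d' = ((y * uH * y⁻¹).1.val : GL (Fin 2) (UnitaryGroup.LocalRing L v)))
    (α' γ' : (w.1.adicCompletion L))
    (hα' : ((((uH.1.val : GL (Fin 2) (LocalRing L v)) : Matrix (Fin 2) (Fin 2) (LocalRing L v)).charpoly).map (Pi.evalRingHom (fun w' : PlacesOver L v => w'.1.adicCompletion L) w)).IsRoot α')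
    (hγ' : ((((uH.1.val : GL (Fin 2) (LocalRing L v)) : Matrix (Fin 2) (Fin 2) (LocalRing L v)).charpoly).map (Pi.evalRingHom (fun w' : PlacesOver L v => w'.1.adicCompletion L) w)).IsRoot γ')
    (hαγ' : α' ≠ γ') (hN' : Valued.v (α' - γ') = WithZero.exp (-((N - 1 : ℕ) : ℤ)))
    (hα1' : Valued.v (α' - 1) < 1) (hγ1' : Valued.v (γ' - 1) < 1) (h2N : 2 ≤ N)
    (χdec₀ : ∀ h : ((cmDatum L 2 (Matrix.of fun i j : Fin 2 => if i.val + j.val + 1 = 2 then (1 : L) else 0)).Local v × (cmDatum L 1 (Matrix.of fun i j : Fin 1 => if i.val + j.val + 1 = 1 then (1 : L) else 0)).Local v), Decidable ((redMat (((h).1.val : GL (Fin 2) (UnitaryGroup.LocalRing L v)).val.map (Pi.evalRingHom (fun w' : PlacesOver L v => w'.1.adicCompletion L) w)) - 1) ^ 2 = 0 ∧ (redMat (((h).1.val : GL (Fin 2) (UnitaryGroup.LocalRing L v)).val.map (Pi.evalRingHom (fun w' : PlacesOver L v => w'.1.adicCompletion L) w)) - 1).rank = 0)) (χdec₁ : ∀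 h : ((cmDatum L 2 (Matrix.of fun i j : Fin 2 => if i.val + j.val + 1 = 2 then (1 : L) else 0)).Local v × (cmDatum L 1 (Matrix.of fun i j : Fin 1 => if i.val + j.val + 1 = 1 then (1 : L) else 0)).Local v), Decidable ((redMat (((h).1.val : GL (Fin 2) (UnitaryGroup.LocalRing L v)).val.map (Pi.evalRingHom (fun w' : PlacesOver L v => w'.1.adicCompletion L) w)) - 1) ^ 2 = 0 ∧ (redMat (((h).1.val : GL (Fin 2) (UnitaryGroup.LocalRing L v)).val.map (Pi.evalRingHom (fun w' : PlacesOver L v => w'.1.adicCompletion L) w)) - 1).rank = 1)) :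
    stableOrbitalIntegralRel (IsLocalStablyConjH L v) mH (((((cmLocalIntegralLevel L 2 (Matrix.of fun i j : Fin 2 => if i.val + j.val + 1 = 2 then (1 : L) else 0) v).prod (cmLocalIntegralLevel L 1 (Matrix.of fun i j : Fin 1 => if i.val + j.val + 1 = 1 then (1 : L) else 0) v)) : Subgroup ((cmDatum L 2 (Matrix.of fun i j : Fin 2 => if i.val + j.val + 1 = 2 then (1 : L) else 0)).Local v × (cmDatum L 1 (Matrix.of fun i j : Fin 1 => if i.val + j.val + 1 = 1 then (1 : L) else 0)).Local v)) : Set ((cmDatum L 2 (Matrix.of fun i j : Fin 2 => if i.val + j.val + 1 = 2 then (1 : L) else 0)).Local v × (cmDatum L 1 (Matrix.of fun i j : Fin 1 => if i.val + j.val + 1 = 1 then (1 : L) else 0)).Local v)).indicator fun h => if (redMat (((h).1.val : GL (Fin 2) (UnitaryGroup.LocalRing L v)).val.map (Pi.evalRingHom (fun w' : PlacesOver L v => w'.1.adicCompletion L) w)) - 1) ^ 2 = 0 ∧ (redMat (((h).1.val : GL (Fin 2) (UnitaryGroup.LocalRing L v)).val.map (Pi.evalRingHom (fun w' : PlacesOver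 L v => w'.1.adicCompletion L) w)) - 1).rank = 0 then (1 : ℂ) else 0) uH =
        stableOrbitalIntegralRel (IsLocalStablyConjH L v) mH (((((cmLocalIntegralLevel L 2 (Matrix.of fun i j : Fin 2 => if i.val + j.val + 1 = 2 then (1 : L) else 0) v).prod (cmLocalIntegralLevel L 1 (Matrix.of fun i j : Fin 1 => if i.val + j.val + 1 = 1 then (1 : L) else 0) v)) : Subgroup ((cmDatum L 2 (Matrix.of fun i j : Fin 2 => if i.val + j.val + 1 = 2 then (1 : L) else 0)).Local v × (cmDatum L 1 (Matrix.of fun i j : Fin 1 => if i.val + j.val + 1 = 1 then (1 : L) else 0)).Local v)) : Set ((cmDatum L 2 (Matrix.of fun i j : Fin 2 => if i.val + j.val + 1 = 2 then (1 : L) else 0)).Local v × (cmDatum L 1 (Matrix.of fun i j : Fin 1 => if i.val + j.val + 1 = 1 then (1 : L) else 0)).Local v)).indicator fun h => if (redMat (((h).1.val : GL (Fin 2) (UnitaryGroup.LocalRing L v)).val.map (Pi.evalRingHom (fun w' : PlacesOver L v => w'.1.adicCompletion L) w)) - 1) ^ 2 = 0 ∧ (redMat (((h).1.val : GL (Fin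 2) (UnitaryGroup.LocalRing L v)).val.map (Pi.evalRingHom (fun w' : PlacesOver L v => w'.1.adicCompletion L) w)) - 1).rank = 0 then (1 : ℂ) else 0) γH -
          ((Ideal.absNorm v.asIdeal : ℕ) : ℂ)⁻¹ * stableOrbitalIntegralRel (IsLocalStablyConjH L v) mH (((((cmLocalIntegralLevel L 2 (Matrix.of fun i j : Fin 2 => if i.val + j.val + 1 = 2 then (1 : L) else 0) v).prod (cmLocalIntegralLevel L 1 (Matrix.of fun i j : Fin 1 => if i.val + j.val + 1 = 1 then (1 : L) else 0) v)) : Subgroup ((cmDatum L 2 (Matrix.of fun i j : Fin 2 => if i.val + j.val + 1 = 2 then (1 : L) else 0)).Local v × (cmDatum L 1 (Matrix.of fun i j : Fin 1 => if i.val + j.val + 1 = 1 then (1 : L) else 0)).Local v)) : Set ((cmDatum L 2 (Matrix.of fun i j : Fin 2 => if i.val + j.val + 1 = 2 then (1 : L) else 0)).Local v × (cmDatum L 1 (Matrix.of fun i j : Fin 1 => if i.val + j.val + 1 = 1 then (1 : L) else 0)).Local v)).indicator fun h => if (redMat (((h).1.val : GL (Fin 2) (UnitaryGroup.LocalRing L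 v)).val.map (Pi.evalRingHom (fun w' : PlacesOver L v => w'.1.adicCompletion L) w)) - 1) ^ 2 = 0 ∧ (redMat (((h).1.val : GL (Fin 2) (UnitaryGroup.LocalRing L v)).val.map (Pi.evalRingHom (fun w' : PlacesOver L v => w'.1.adicCompletion L) w)) - 1).rank = 1 then (1 : ℂ) else 0) γH ∧
      stableOrbitalIntegralRel (IsLocalStablyConjH L v) mH (((((cmLocalIntegralLevel L 2 (Matrix.of fun i j : Fin 2 => if i.val + j.val + 1 = 2 then (1 : L) else 0) v).prod (cmLocalIntegralLevel L 1 (Matrix.of fun i j : Fin 1 => if i.val + j.val + 1 = 1 then (1 : L) else 0) v)) : Subgroup ((cmDatum L 2 (Matrix.of fun i j : Fin 2 => if i.val + j.val + 1 = 2 then (1 : L) else 0)).Local v × (cmDatum L 1 (Matrix.of fun i j : Fin 1 => if i.val + j.val + 1 = 1 then (1 : L) else 0)).Local v)) : Set ((cmDatum L 2 (Matrix.of fun i j : Fin 2 => if i.val + j.val + 1 = 2 then (1 : L) else 0)).Local v × (cmDatum L 1 (Matrix.of fun i j : Fin 1 => if i.val + j.val + 1 = 1 then (1 : L) else 0)).Local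 v)).indicator fun h => if (redMat (((h).1.val : GL (Fin 2) (UnitaryGroup.LocalRing L v)).val.map (Pi.evalRingHom (fun w' : PlacesOver L v => w'.1.adicCompletion L) w)) - 1) ^ 2 = 0 ∧ (redMat (((h).1.val : GL (Fin 2) (UnitaryGroup.LocalRing L v)).val.map (Pi.evalRingHom (fun w' : PlacesOver L v => w'.1.adicCompletion L) w)) - 1).rank = 1 then (1 : ℂ) else 0) uH =
        ((Ideal.absNorm v.asIdeal : ℕ) : ℂ)⁻¹ * stableOrbitalIntegralRel (IsLocalStablyConjH L v) mH (((((cmLocalIntegralLevel L 2 (Matrix.of fun i j : Fin 2 => if i.val + j.val + 1 = 2 then (1 : L) else 0) v).prod (cmLocalIntegralLevel L 1 (Matrix.of fun i j : Fin 1 => if i.val + j.val + 1 = 1 then (1 : L) else 0) v)) : Subgroup ((cmDatum L 2 (Matrix.of fun i j : Fin 2 => if i.val + j.val + 1 = 2 then (1 : L) else 0)).Local v × (cmDatum L 1 (Matrix.of fun i j : Fin 1 => if i.val + j.val + 1 = 1 then (1 : L) else 0)).Local v)) : Set ((cmDatum L 2 (Matrix.of fun i j : Fin 2 => if i.val + j.val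 + 1 = 2 then (1 : L) else 0)).Local v × (cmDatum L 1 (Matrix.of fun i j : Fin 1 => if i.val + j.val + 1 = 1 then (1 : L) else 0)).Local v)).indicator fun h => if (redMat (((h).1.val : GL (Fin 2) (UnitaryGroup.LocalRing L v)).val.map (Pi.evalRingHom (fun w' : PlacesOver L v => w'.1.adicCompletion L) w)) - 1) ^ 2 = 0 ∧ (redMat (((h).1.val : GL (Fin 2) (UnitaryGroup.LocalRing L v)).val.map (Pi.evalRingHom (fun w' : PlacesOver L v => w'.1.adicCompletion L) w)) - 1).rank = 1 then (1 : ℂ) else 0) γH := by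
  have hq : 1 < Ideal.absNorm v.asIdeal := NumberField.HeightOneSpectrum.one_lt_absNorm v
  obtain ⟨e1, e2⟩ := phiH_sub_two_eq hq h2N
  rw [show N - 2 = N - 1 - 1 by omega] at e1 e2
  -- the two scalar identities, cast to `ℂ`
  have E1 : ((Flicker1998.phiH (Ideal.absNorm v.asIdeal) (N - 1 - 1) : ℚ) : ℂ) = ((Flicker1998.phiH (Ideal.absNorm v.asIdeal) (N - 1) : ℚ) : ℂ) -
      ((Ideal.absNorm v.asIdeal : ℕ) : ℂ)⁻¹ * ((Flicker1998.phiH (Ideal.absNorm v.asIdeal) N - Flicker1998.phiH (Ideal.absNorm v.asIdeal) (N - 1) : ℚ) : ℂ) := by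
    rw [e1]; push_cast; ring
  have E2 : ((Flicker1998.phiH (Ideal.absNorm v.asIdeal) (N - 1) - Flicker1998.phiH (Ideal.absNorm v.asIdeal) (N - 1 - 1) : ℚ) : ℂ) =
      ((Ideal.absNorm v.asIdeal : ℕ) : ℂ)⁻¹ * ((Flicker1998.phiH (Ideal.absNorm v.asIdeal) N - Flicker1998.phiH (Ideal.absNorm v.asIdeal) (N - 1) : ℚ) : ℂ) := by
    rw [e2]; push_cast; ring
  -- the four stable values (★ FILE B heads at depths `N − 1` and `N`)
  have h0u := stableOrbitalIntegralRel_chiZero_eq_mul_phiH_of_isRoot L v w hw νH hv hmH hreg' hell' α' γ' hα' hγ' hαγ' (N - 1) hN' hα1' hγ1' χdec₀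
  have h1u := stableOrbitalIntegralRel_chiOne_eq_mul_phiH_sub_of_isRoot L v w hw νH hv hmH hreg' hell' α' γ' hα' hγ' hαγ' (N - 1) hN' hα1' hγ1' χdec₀ χdec₁
  have h0g := stableOrbitalIntegralRel_chiZero_eq_mul_phiH_of_isRoot L v w hw νH hv hmH hreg hell α γ hα hγ hαγ N hN hα1 hγ1 χdec₀
  have h1g := stableOrbitalIntegralRel_chiOne_eq_mul_phiH_sub_of_isRoot L v w hw νH hv hmH hreg hell α γ hα hγ hαγ N hN hα1 hγ1 χdec₀ χdec₁
  constructor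
  · linear_combination h0u - h0g + ((Ideal.absNorm v.asIdeal : ℕ) : ℂ)⁻¹ * h1g + (νH.real ((((cmLocalIntegralLevel L 2 (Matrix.of fun i j : Fin 2 => if i.val + j.val + 1 = 2 then (1 : L) else 0) v).prod (cmLocalIntegralLevel L 1 (Matrix.of fun i j : Fin 1 => if i.val + j.val + 1 = 1 then (1 : L) else 0) v)) : Subgroup ((cmDatum L 2 (Matrix.of fun i j : Fin 2 => if i.val + j.val + 1 = 2 then (1 : L) else 0)).Local v × (cmDatum L 1 (Matrix.of fun i j : Fin 1 => if i.val + j.val + 1 = 1 then (1 : L) else 0)).Local v)) : Set ((cmDatum L 2 (Matrix.of fun i j : Fin 2 => if i.val + j.val + 1 = 2 then (1 : L) else 0)).Local v × (cmDatum L 1 (Matrix.of fun i j : Fin 1 => if i.val + j.val + 1 = 1 then (1 : L) else 0)).Local v)) : ℂ) * E1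
  · linear_combination h1u - ((Ideal.absNorm v.asIdeal : ℕ) : ℂ)⁻¹ * h1g + (νH.real ((((cmLocalIntegralLevel L 2 (Matrix.of fun i j : Fin 2 => if i.val + j.val + 1 = 2 then (1 : L) else 0) v).prod (cmLocalIntegralLevel L 1 (Matrix.of fun i j : Fin 1 => if i.val + j.val + 1 = 1 then (1 : L) else 0) v)) : Subgroup ((cmDatum L 2 (Matrix.of fun i j : Fin 2 => if i.val + j.val + 1 = 2 then (1 : L) else 0)).Local v × (cmDatum L 1 (Matrix.of fun i j : Fin 1 => if i.val + j.val + 1 = 1 then (1 : L) else 0)).Local v)) : Set ((cmDatum L 2 (Matrix.of fun i j : Fin 2 => if i.val + j.val + 1 = 2 then (1 : L) else 0)).Local v × (cmDatum L 1 (Matrix.of fun i j : Fin 1 => if i.val + j.val + 1 = 1 then (1 : L) else 0)).Local v)) : ℂ) * E2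

set_option maxHeartbeats 400000 in
include hw in
/-- **H-SIDE SHIFT, TYPE (2): `Φ^st(u_H, χ₀) = Φ^st(γ_H, χ₀) − q⁻¹·Φ^st(γ_H, χ₁)` and `Φ^st(u_H, χ₁) = q⁻¹·Φ^st(γ_H, χ₁)`** for `G`-regular `γ_H, u_H` of type (2)
(irreducible `w`-characteristic polynomial of the `U(2)`-component) which are deep by trace and determinant, at discriminant depths `N ≥ 2` and `N − 1` (same frame as ★
`stableOrbitalIntegralRel_chiZero_eq_mul_phiHtwo_of_not_exists_isRoot` ∕ `…chiOne_eq_mul_phiHtwo_sub_…`), by §2 `phiHtwo_sub_two_eq` — the SAME matrix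
`S = !![1, −q⁻¹; 0, q⁻¹]` as for type (1) (A-91b).  Decidability binders `χdec₀ χdec₁` (pass `_`).
[cite: Rogawski1990, §4.9 Prop. 4.9.1 (b) p. 55] [cite: Kottwitz1986, §3] [cite: Flicker1998UnitaryFL, §6 p. 97] -/
theorem stableOrbitalIntegralRel_chi_shift_of_not_exists_isRoot (hunr : Algebra.IsUnramifiedIn (𝓞 L) v.asIdeal)
    {mH : OrbitalMeasureFamily ((cmDatum L 2 (Matrix.of fun i j : Fin 2 => if i.val + j.val + 1 = 2 then (1 : L) else 0)).Local v × (cmDatum L 1 (Matrix.of fun i j : Fin 1 => if i.val + j.val + 1 = 1 then (1 : L) else 0)).Local v)} (hmH : mH.IsCanonical (IsLocalGRegular L v) νH)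
    (h2 : IsUnit (2 : 𝒪[(w.1.adicCompletion L)]))
    {γH : (cmDatum L 2 (Matrix.of fun i j : Fin 2 => if i.val + j.val + 1 = 2 then (1 : L) else 0)).Local v × (cmDatum L 1 (Matrix.of fun i j : Fin 1 => if i.val + j.val + 1 = 1 then (1 : L) else 0)).Local v} (hreg : IsLocalGRegular L v γH)
    [CompactSpace (Subgroup.centralizer ({γH.1} : Set ((cmDatum L 2 (Matrix.of fun i j : Fin 2 => if i.val + j.val + 1 = 2 then (1 : L) else 0)).Local v)))]
    (hint : ∀ i : ℕ, ((((endoEmbLocal L v γH).val : GL (Fin 3) (LocalRing L v)).val.map (Pi.evalRingHom (fun w' : PlacesOver L v => w'.1.adicCompletion L) w)).charpoly.coeff i) ∈ 𝒪[(w.1.adicCompletion L)])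
    (hirr : ¬ ∃ x : (w.1.adicCompletion L), (((((γH).1.val : GL (Fin 2) (UnitaryGroup.LocalRing L v)).val.map (Pi.evalRingHom (fun w' : PlacesOver L v => w'.1.adicCompletion L) w))).charpoly).IsRoot x)
    (N : ℕ) (hN : Valued.v (((((γH).1.val : GL (Fin 2) (UnitaryGroup.LocalRing L v)).val.map (Pi.evalRingHom (fun w' : PlacesOver L v => w'.1.adicCompletion L) w))).trace ^ 2 - 4 * ((((γH).1.val : GL (Fin 2) (UnitaryGroup.LocalRing L v)).val.map (Pi.evalRingHom (fun w' : PlacesOver L v => w'.1.adicCompletion L) w))).det) = WithZero.exp (-((2 * N + 1 : ℕ) : ℤ)))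
    (htr : Valued.v (((((γH).1.val : GL (Fin 2) (UnitaryGroup.LocalRing L v)).val.map (Pi.evalRingHom (fun w' : PlacesOver L v => w'.1.adicCompletion L) w))).trace - 2) < 1) (hdet : Valued.v (((((γH).1.val : GL (Fin 2) (UnitaryGroup.LocalRing L v)).val.map (Pi.evalRingHom (fun w' : PlacesOver L v => w'.1.adicCompletion L) w))).det - 1) < 1)
    {uH : (cmDatum L 2 (Matrix.of fun i j : Fin 2 => if i.val + j.val + 1 = 2 then (1 : L) else 0)).Local v × (cmDatum L 1 (Matrix.of fun i j : Fin 1 => if i.val + j.val + 1 = 1 then (1 : L) else 0)).Local v} (hreg' : IsLocalGRegular L v uH)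
    [CompactSpace (Subgroup.centralizer ({uH.1} : Set ((cmDatum L 2 (Matrix.of fun i j : Fin 2 => if i.val + j.val + 1 = 2 then (1 : L) else 0)).Local v)))]
    (hint' : ∀ i : ℕ, ((((endoEmbLocal L v uH).val : GL (Fin 3) (LocalRing L v)).val.map (Pi.evalRingHom (fun w' : PlacesOver L v => w'.1.adicCompletion L) w)).charpoly.coeff i) ∈ 𝒪[(w.1.adicCompletion L)])
    (hirr' : ¬ ∃ x : (w.1.adicCompletion L), (((((uH).1.val : GL (Fin 2) (UnitaryGroup.LocalRing L v)).val.map (Pi.evalRingHom (fun w' : PlacesOver L v => w'.1.adicCompletion L) w))).charpoly).IsRoot x)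
    (hN' : Valued.v (((((uH).1.val : GL (Fin 2) (UnitaryGroup.LocalRing L v)).val.map (Pi.evalRingHom (fun w' : PlacesOver L v => w'.1.adicCompletion L) w))).trace ^ 2 - 4 * ((((uH).1.val : GL (Fin 2) (UnitaryGroup.LocalRing L v)).val.map (Pi.evalRingHom (fun w' : PlacesOver L v => w'.1.adicCompletion L) w))).det) = WithZero.exp (-((2 * (N - 1) + 1 : ℕ) : ℤ)))
    (htr' : Valued.v (((((uH).1.val : GL (Fin 2) (UnitaryGroup.LocalRing L v)).val.map (Pi.evalRingHom (fun w' : PlacesOver L v => w'.1.adicCompletion L) w))).trace - 2) < 1) (hdet' : Valued.v (((((uH).1.val : GL (Fin 2) (UnitaryGroup.LocalRing L v)).val.map (Pi.evalRingHom (fun w' : PlacesOver L v => w'.1.adicCompletion L) w))).det - 1) < 1) (h2N : 2 ≤ N)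
    (χdec₀ : ∀ h : ((cmDatum L 2 (Matrix.of fun i j : Fin 2 => if i.val + j.val + 1 = 2 then (1 : L) else 0)).Local v × (cmDatum L 1 (Matrix.of fun i j : Fin 1 => if i.val + j.val + 1 = 1 then (1 : L) else 0)).Local v), Decidable ((redMat (((h).1.val : GL (Fin 2) (UnitaryGroup.LocalRing L v)).val.map (Pi.evalRingHom (fun w' : PlacesOver L v => w'.1.adicCompletion L) w)) - 1) ^ 2 = 0 ∧ (redMat (((h).1.val : GL (Fin 2) (UnitaryGroup.LocalRing L v)).val.map (Pi.evalRingHom (fun w' : PlacesOver L v => w'.1.adicCompletion L) w)) - 1).rank = 0)) (χdec₁ : ∀ h : ((cmDatum L 2 (Matrix.of fun i j : Fin 2 => if i.val + j.val + 1 = 2 then (1 : L) else 0)).Local v × (cmDatum L 1 (Matrix.of fun i j : Fin 1 => if i.val + j.val + 1 = 1 then (1 : L) else 0)).Local v), Decidable ((redMat (((h).1.val : GL (Fin 2) (UnitaryGroup.LocalRing L v)).val.map (Pi.evalRingHom (fun w' : PlacesOver L v => w'.1.adicCompletion L) w)) - 1) ^ 2 = 0 ∧ (redMat (((h).1.val :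 GL (Fin 2) (UnitaryGroup.LocalRing L v)).val.map (Pi.evalRingHom (fun w' : PlacesOver L v => w'.1.adicCompletion L) w)) - 1).rank = 1)) :
    stableOrbitalIntegralRel (IsLocalStablyConjH L v) mH (((((cmLocalIntegralLevel L 2 (Matrix.of fun i j : Fin 2 => if i.val + j.val + 1 = 2 then (1 : L) else 0) v).prod (cmLocalIntegralLevel L 1 (Matrix.of fun i j : Fin 1 => if i.val + j.val + 1 = 1 then (1 : L) else 0) v)) : Subgroup ((cmDatum L 2 (Matrix.of fun i j : Fin 2 => if i.val + j.val + 1 = 2 then (1 : L) else 0)).Local v × (cmDatum L 1 (Matrix.of fun i j : Fin 1 => if i.val + j.val + 1 = 1 then (1 : L) else 0)).Local v)) : Set ((cmDatum L 2 (Matrix.of fun i j : Fin 2 => if i.val + j.val + 1 = 2 then (1 : L) else 0)).Local v × (cmDatum L 1 (Matrix.of fun i j : Fin 1 => if i.val + j.val + 1 = 1 then (1 : L) else 0)).Local v)).indicator fun h => if (redMat (((h).1.val : GL (Fin 2) (UnitaryGroup.LocalRing L v)).val.map (Pi.evalRingHom (fun w' : PlacesOver L v => w'.1.adicCompletion L)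 w)) - 1) ^ 2 = 0 ∧ (redMat (((h).1.val : GL (Fin 2) (UnitaryGroup.LocalRing L v)).val.map (Pi.evalRingHom (fun w' : PlacesOver L v => w'.1.adicCompletion L) w)) - 1).rank = 0 then (1 : ℂ) else 0) uH =
        stableOrbitalIntegralRel (IsLocalStablyConjH L v) mH (((((cmLocalIntegralLevel L 2 (Matrix.of fun i j : Fin 2 => if i.val + j.val + 1 = 2 then (1 : L) else 0) v).prod (cmLocalIntegralLevel L 1 (Matrix.of fun i j : Fin 1 => if i.val + j.val + 1 = 1 then (1 : L) else 0) v)) : Subgroup ((cmDatum L 2 (Matrix.of fun i j : Fin 2 => if i.val + j.val + 1 = 2 then (1 : L) else 0)).Local v × (cmDatum L 1 (Matrix.of fun i j : Fin 1 => if i.val + j.val + 1 = 1 then (1 : L) else 0)).Local v)) : Set ((cmDatum L 2 (Matrix.of fun i j : Fin 2 => if i.val + j.val + 1 = 2 then (1 : L) else 0)).Local v × (cmDatum L 1 (Matrix.of fun i j : Fin 1 => if i.val + j.val + 1 = 1 then (1 : L) else 0)).Local v)).indicator fun h => if (redMat (((h).1.val : GL (Fin 2) (UnitaryGroup.LocalRing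 L v)).val.map (Pi.evalRingHom (fun w' : PlacesOver L v => w'.1.adicCompletion L) w)) - 1) ^ 2 = 0 ∧ (redMat (((h).1.val : GL (Fin 2) (UnitaryGroup.LocalRing L v)).val.map (Pi.evalRingHom (fun w' : PlacesOver L v => w'.1.adicCompletion L) w)) - 1).rank = 0 then (1 : ℂ) else 0) γH -
          ((Ideal.absNorm v.asIdeal : ℕ) : ℂ)⁻¹ * stableOrbitalIntegralRel (IsLocalStablyConjH L v) mH (((((cmLocalIntegralLevel L 2 (Matrix.of fun i j : Fin 2 => if i.val + j.val + 1 = 2 then (1 : L) else 0) v).prod (cmLocalIntegralLevel L 1 (Matrix.of fun i j : Fin 1 => if i.val + j.val + 1 = 1 then (1 : L) else 0) v)) : Subgroup ((cmDatum L 2 (Matrix.of fun i j : Fin 2 => if i.val + j.val + 1 = 2 then (1 : L) else 0)).Local v × (cmDatum L 1 (Matrix.of fun i j : Fin 1 => if i.val + j.val + 1 = 1 then (1 : L) else 0)).Local v)) : Set ((cmDatum L 2 (Matrix.of fun i j : Fin 2 => if i.val + j.val + 1 = 2 then (1 : L) else 0)).Local v × (cmDatum L 1 (Matrix.of fun i j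 : Fin 1 => if i.val + j.val + 1 = 1 then (1 : L) else 0)).Local v)).indicator fun h => if (redMat (((h).1.val : GL (Fin 2) (UnitaryGroup.LocalRing L v)).val.map (Pi.evalRingHom (fun w' : PlacesOver L v => w'.1.adicCompletion L) w)) - 1) ^ 2 = 0 ∧ (redMat (((h).1.val : GL (Fin 2) (UnitaryGroup.LocalRing L v)).val.map (Pi.evalRingHom (fun w' : PlacesOver L v => w'.1.adicCompletion L) w)) - 1).rank = 1 then (1 : ℂ) else 0) γH ∧
      stableOrbitalIntegralRel (IsLocalStablyConjH L v) mH (((((cmLocalIntegralLevel L 2 (Matrix.of fun i j : Fin 2 => if i.val + j.val + 1 = 2 then (1 : L) else 0) v).prod (cmLocalIntegralLevel L 1 (Matrix.of fun i j : Fin 1 => if i.val + j.val + 1 = 1 then (1 : L) else 0) v)) : Subgroup ((cmDatum L 2 (Matrix.of fun i j : Fin 2 => if i.val + j.val + 1 = 2 then (1 : L) else 0)).Local v × (cmDatum L 1 (Matrix.of fun i j : Fin 1 => if i.val + j.val + 1 = 1 then (1 : L) else 0)).Local v)) : Set ((cmDatum L 2 (Matrix.of fun i j : Fin 2 => if i.val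 + j.val + 1 = 2 then (1 : L) else 0)).Local v × (cmDatum L 1 (Matrix.of fun i j : Fin 1 => if i.val + j.val + 1 = 1 then (1 : L) else 0)).Local v)).indicator fun h => if (redMat (((h).1.val : GL (Fin 2) (UnitaryGroup.LocalRing L v)).val.map (Pi.evalRingHom (fun w' : PlacesOver L v => w'.1.adicCompletion L) w)) - 1) ^ 2 = 0 ∧ (redMat (((h).1.val : GL (Fin 2) (UnitaryGroup.LocalRing L v)).val.map (Pi.evalRingHom (fun w' : PlacesOver L v => w'.1.adicCompletion L) w)) - 1).rank = 1 then (1 : ℂ) else 0) uH =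
        ((Ideal.absNorm v.asIdeal : ℕ) : ℂ)⁻¹ * stableOrbitalIntegralRel (IsLocalStablyConjH L v) mH (((((cmLocalIntegralLevel L 2 (Matrix.of fun i j : Fin 2 => if i.val + j.val + 1 = 2 then (1 : L) else 0) v).prod (cmLocalIntegralLevel L 1 (Matrix.of fun i j : Fin 1 => if i.val + j.val + 1 = 1 then (1 : L) else 0) v)) : Subgroup ((cmDatum L 2 (Matrix.of fun i j : Fin 2 => if i.val + j.val + 1 = 2 then (1 : L) else 0)).Local v × (cmDatum L 1 (Matrix.of fun i j : Fin 1 => if i.val + j.val + 1 = 1 then (1 : L) else 0)).Local v)) : Set ((cmDatum L 2 (Matrix.of fun i j : Fin 2 => if i.val + j.val + 1 = 2 then (1 : L) else 0)).Local v × (cmDatum L 1 (Matrix.of fun i j : Fin 1 => if i.val + j.val + 1 = 1 then (1 : L) else 0)).Local v)).indicator fun h => if (redMat (((h).1.val : GL (Fin 2) (UnitaryGroup.LocalRing L v)).val.map (Pi.evalRingHom (fun w' : PlacesOver L v => w'.1.adicCompletion L) w)) - 1) ^ 2 = 0 ∧ (redMat (((h).1.val : GL (Fin 2) (UnitaryGroup.LocalRing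 L v)).val.map (Pi.evalRingHom (fun w' : PlacesOver L v => w'.1.adicCompletion L) w)) - 1).rank = 1 then (1 : ℂ) else 0) γH := by
  have hq : 1 < Ideal.absNorm v.asIdeal := NumberField.HeightOneSpectrum.one_lt_absNorm v
  obtain ⟨e1, e2⟩ := phiHtwo_sub_two_eq hq h2N
  rw [show N - 2 = N - 1 - 1 by omega] at e1 e2
  have hN1 : 1 ≤ N := by omega
  have hN1' : 1 ≤ N - 1 := by omega
  -- the two scalar identities, cast to `ℂ`
  have E1 : ((Flicker1998.phiHtwo (Ideal.absNorm v.asIdeal) (N - 1 - 1) : ℚ) : ℂ) = ((Flicker1998.phiHtwo (Ideal.absNorm v.asIdeal) (N - 1) : ℚ) : ℂ) -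
      ((Ideal.absNorm v.asIdeal : ℕ) : ℂ)⁻¹ * ((Flicker1998.phiHtwo (Ideal.absNorm v.asIdeal) N - Flicker1998.phiHtwo (Ideal.absNorm v.asIdeal) (N - 1) : ℚ) : ℂ) := by
    rw [e1]; push_cast; ring
  have E2 : ((Flicker1998.phiHtwo (Ideal.absNorm v.asIdeal) (N - 1) - Flicker1998.phiHtwo (Ideal.absNorm v.asIdeal) (N - 1 - 1) : ℚ) : ℂ) =
      ((Ideal.absNorm v.asIdeal : ℕ) : ℂ)⁻¹ * ((Flicker1998.phiHtwo (Ideal.absNorm v.asIdeal) N - Flicker1998.phiHtwo (Ideal.absNorm v.asIdeal) (N - 1) : ℚ) : ℂ) := by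
    rw [e2]; push_cast; ring
  -- the four stable values (★ FILE D heads at depths `N − 1` and `N`)
  have h0u := stableOrbitalIntegralRel_chiZero_eq_mul_phiHtwo_of_not_exists_isRoot L v w hw νH hunr hmH hreg' h2 hint' hirr' (N - 1) hN' hN1' htr' χdec₀
  have h1u := stableOrbitalIntegralRel_chiOne_eq_mul_phiHtwo_sub_of_not_exists_isRoot L v w hw νH hunr hmH hreg' h2 hint' hirr' (N - 1) hN' hN1' htr' hdet' χdec₀ χdec₁
  have h0g := stableOrbitalIntegralRel_chiZero_eq_mul_phiHtwo_of_not_exists_isRoot L v w hw νH hunr hmH hreg h2 hint hirr N hN hN1 htr χdec₀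
  have h1g := stableOrbitalIntegralRel_chiOne_eq_mul_phiHtwo_sub_of_not_exists_isRoot L v w hw νH hunr hmH hreg h2 hint hirr N hN hN1 htr hdet χdec₀ χdec₁
  constructor
  · linear_combination h0u - h0g + ((Ideal.absNorm v.asIdeal : ℕ) : ℂ)⁻¹ * h1g + (νH.real ((((cmLocalIntegralLevel L 2 (Matrix.of fun i j : Fin 2 => if i.val + j.val + 1 = 2 then (1 : L) else 0) v).prod (cmLocalIntegralLevel L 1 (Matrix.of fun i j : Fin 1 => if i.val + j.val + 1 = 1 then (1 : L) else 0) v)) : Subgroup ((cmDatum L 2 (Matrix.of fun i j : Fin 2 => if i.val + j.val + 1 = 2 then (1 : L) else 0)).Local v × (cmDatum L 1 (Matrix.of fun i j : Fin 1 => if i.val + j.val + 1 = 1 then (1 : L) else 0)).Local v)) : Set ((cmDatum L 2 (Matrix.of fun i j : Fin 2 => if i.val + j.val + 1 = 2 then (1 : L) else 0)).Local v × (cmDatum L 1 (Matrix.of fun i j : Fin 1 => if i.val + j.val + 1 = 1 then (1 : L) else 0)).Local v)) : ℂ) * E1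
  · linear_combination h1u - ((Ideal.absNorm v.asIdeal : ℕ) : ℂ)⁻¹ * h1g + (νH.real ((((cmLocalIntegralLevel L 2 (Matrix.of fun i j : Fin 2 => if i.val + j.val + 1 = 2 then (1 : L) else 0) v).prod (cmLocalIntegralLevel L 1 (Matrix.of fun i j : Fin 1 => if i.val + j.val + 1 = 1 then (1 : L) else 0) v)) : Subgroup ((cmDatum L 2 (Matrix.of fun i j : Fin 2 => if i.val + j.val + 1 = 2 then (1 : L) else 0)).Local v × (cmDatum L 1 (Matrix.of fun i j : Fin 1 => if i.val + j.val + 1 = 1 then (1 : L) else 0)).Local v)) : Set ((cmDatum L 2 (Matrix.of fun i j : Fin 2 => if i.val + j.val + 1 = 2 then (1 : L) else 0)).Local v × (cmDatum L 1 (Matrix.of fun i j : Fin 1 => if i.val + j.val + 1 = 1 then (1 : L) else 0)).Local v)) : ℂ) * E2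

end Place

end Literature.NumberTheory.Automorphic.UnitaryGroup

end
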